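import Summits.NavierStokesRegularity.NavierStokesRegularity.Theorems.SqueezeCycleSingularProfileOfNontrivialMorreyPotential
import Summits.NavierStokesRegularity.NavierStokesRegularity.Theorems.SqueezeCycleSingularProfileOfNontrivialProbeBounds

/-!
# Route SqueezeCycle · item `SingularProfileOfNontrivial` (stmt-NavierStokesRegularity-15368):
# the duality bound for `Q[v]` and the potential probe term on the MORREY class

Helper file (theorems only): the Morrey-class twin of `PineauVicolPressureDuality.lean`:
`|∫ Q[v](x) ψ(R⁻¹(x − x₀)) dx| ≤ M_ψ A R³` for `R ≥ 1` (near part by Fubini and two integrations by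
parts with the local energy `∫_{B̄(x₀,ρR)}|v|² ≤ A R(ρ+1)`, far part by the uniform bound
`|Q₂^{R,2R}[v]| ≤ K A`), whence the potential probe term of Tao's argument is `O(A/R)`.

References: T. Tao, Anal. PDE 6 (2013), §4, proof of Lemma 4.1 (i) [Tao2011]; D. Albritton, T. Barker,
J. Math. Fluid Mech. 21 (2019) = arXiv:1811.00502, §1, §3 [AlbrittonBarker2019]; G. Koch, N. Nadirashvili,
G. Seregin, V. Šverák, Acta Math. 203 (2009) [KochNadirashviliSereginSverak2009].
-/

noncomputable section

-- the sub-problem namespace repeats the summit name (D-0017 layout `Summit.<S>.<P>.Theorems`)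
set_option linter.dupNamespace false
-- nested operator types `ℝ³ →L[ℝ] ℝ³ →L[ℝ] ℝ³ →L[ℝ] ℝ` (pressure kernels)
set_option maxSynthPendingDepth 3

namespace Summit.NavierStokesRegularity.NavierStokesRegularity.Theorems.SingularProfile

open MeasureTheory Set Filter Metric Function
open _root_.Topology
open scoped ENNReal NNReal Laplacian ContDiff RealInnerProductSpace
open Literature.Analysis.FluidPDE
open Literature.Analysis.FluidPDE.FourierNS (HasDecay)

/-- **The duality/dilation bound on the Morrey class.** For a `C²` compactly supported test
function `ψ` there is `M_ψ` with
`|∫ Q[v](x) ψ(R⁻¹(x − x₀)) dx| ≤ M_ψ A R³` for all `R ≥ 1`, `x₀`, and `v ∈ C²` with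
`∫_{B(y,r)} |v|² ≤ A r` (`r ≥ 1`) (as the decay-class
`exists_abs_integral_pressurePotential_mul_le_decay`, with the local energy
`∫_{B̄(x₀, ρR)} |v|² ≤ A R (ρ+1)` in the near part and the uniform bound
`|Q₂^{R,2R}| ≤ K A` in the far part). In the probe of the pressure identification this is
multiplied by the normalisation `R⁻⁴` of `∂χ_R`, hence is `O(A/R)`. [cite: Tao2011, §4, proof of Lemma 4.1 (i)] -/
theorem exists_abs_integral_pressurePotential_mul_le_morrey {ψ : (EuclideanSpace ℝ (Fin 3)) → ℝ}
    (hψ : ContDiff ℝ 2 ψ) (hψc : HasCompactSupport ψ) :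
    ∃ M : ℝ, 0 ≤ M ∧ ∀ (v : (EuclideanSpace ℝ (Fin 3)) → (EuclideanSpace ℝ (Fin 3))) (A : ℝ),
      ContDiff ℝ 2 v →
      (∀ (x : EuclideanSpace ℝ (Fin 3)) (r : ℝ), 1 ≤ r → ∫ y in ball x r, ‖v y‖ ^ 2 ≤ A * r) →
      ∀ (x₀ : EuclideanSpace ℝ (Fin 3)) (R : ℝ), 1 ≤ R →
        |∫ x, pressurePotential v x * ψ (R⁻¹ • (x - x₀))| ≤ M * A * R ^ 3 := by
  -- the constants
  obtain ⟨Kf, hKf0, hKf⟩ := exists_bound_farPotential_scale_morrey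
  obtain ⟨D₂, hD₂⟩ := ((hψ.fderiv_right (m := 1) le_rfl).continuous_fderiv
    one_ne_zero).bounded_above_of_compact_support ((hψc.fderiv (𝕜 := ℝ)).fderiv (𝕜 := ℝ))
  have hD₂0 : 0 ≤ D₂ := (norm_nonneg _).trans (hD₂ 0)
  obtain ⟨rψ, hrψ⟩ := hψc.isCompact.isBounded.subset_closedBall 0
  set rψ' : ℝ := max rψ 0 with hrψ'
  have hrψ'0 : 0 ≤ rψ' := le_max_right _ _
  have hsuppψ : tsupport ψ ⊆ closedBall (0 : EuclideanSpace ℝ (Fin 3)) rψ' :=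
    hrψ.trans (closedBall_subset_closedBall (le_max_left _ _))
  set N₁ : ℝ := ∫ w, |newtonNear (1 : ℝ) 2 (w : EuclideanSpace ℝ (Fin 3))| with hN₁
  have hN₁0 : 0 ≤ N₁ := integral_nonneg fun w => abs_nonneg _
  set Pψ : ℝ := ∫ w, |ψ w| with hPψ
  have hPψ0 : 0 ≤ Pψ := integral_nonneg fun w => abs_nonneg _
  refine ⟨Kf * Pψ + N₁ * D₂ * (rψ' + 3), by positivity, fun v A hv2 hA x₀ R hRge => ?_⟩
  have hR : 0 < R := one_pos.trans_le hRge
  have hvc : Continuous v := hv2.continuous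
  have hA0 : 0 ≤ A := morrey_const_nonneg (w := fun y => ‖v y‖ ^ 2) (fun y => sq_nonneg _) hA
  have hR1 : 0 < R * 1 := by linarith
  have hR2 : R * 1 < R * 2 := by linarith
  -- the dilated test function
  set ψR : (EuclideanSpace ℝ (Fin 3)) → ℝ := fun x => ψ (R⁻¹ • (x - x₀)) with hψR
  have hψRs : ContDiff ℝ 2 ψR := hψ.comp ((contDiff_id.sub contDiff_const).const_smul _)
  have hψRc : HasCompactSupport ψR := hasCompactSupport_comp_inv_smul_sub hψc hR x₀
  have hψRcont : Continuous ψR := hψRs.continuous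
  have hD2ψR : ∀ x, ‖fderiv ℝ (fderiv ℝ ψR) x‖ ≤ R⁻¹ ^ 2 * D₂ := fun x => by
    rw [hψR, fderiv2_comp_inv_smul_sub ψ hR, norm_smul, norm_pow, norm_inv, Real.norm_eq_abs,
      abs_of_pos hR]
    exact mul_le_mul_of_nonneg_left (hD₂ _) (by positivity)
  have hψR1 : ∫ x, |ψR x| = R ^ 3 * Pψ := integral_abs_comp_inv_smul_sub ψ hR x₀
  -- the support of `ψR` and of its second derivative
  have hsuppR : tsupport ψR ⊆ closedBall x₀ (R * rψ') := by
    refine closure_minimal (fun x hx => ?_) isClosed_closedBall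
    rw [mem_closedBall, dist_eq_norm]
    have hx' : R⁻¹ • (x - x₀) ∈ tsupport ψ := subset_closure hx
    have := mem_closedBall_zero_iff.1 (hsuppψ hx')
    rw [norm_smul, norm_inv, Real.norm_eq_abs, abs_of_pos hR] at this
    rwa [inv_mul_le_iff₀ hR] at this
  have hsuppD2 : ∀ x, x ∉ closedBall x₀ (R * rψ') → fderiv ℝ (fderiv ℝ ψR) x = 0 := fun x hx =>
    image_eq_zero_of_notMem_tsupport fun h =>
      hx (hsuppR (tsupport_fderiv_subset ℝ (tsupport_fderiv_subset ℝ h)))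
  -- the source and the potentials at scale `R`
  set G := pressureSource v with hG
  have hGc : Continuous G := (contDiff_pressureSource (n := 0) (by exact_mod_cast hv2)).continuous
  set Q₁ := nearPotential (R * 1) (R * 2) v with hQ₁
  set Q₂ := farPotential (R * 1) (R * 2) v with hQ₂
  have hQ₁c : Continuous Q₁ :=
    (contDiff_nearPotential hR1.le hR2 0 (by exact_mod_cast hv2)).continuous
  have hQ₂c : Continuous Q₂ := (contDiff_farPotential_morrey hR1 hR2 hvc hA).1.continuous
  have hQ : (fun x => pressurePotential v x * ψR x) = fun x => -(Q₁ x * ψR x) - Q₂ x * ψR x := by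
    funext x
    rw [pressurePotential_eq_scale_morrey hR hv2 hA x]
    ring
  have iQ₁ : Integrable fun x => Q₁ x * ψR x :=
    (hQ₁c.mul hψRcont).integrable_of_hasCompactSupport hψRc.mul_left
  have iQ₂ : Integrable fun x => Q₂ x * ψR x :=
    (hQ₂c.mul hψRcont).integrable_of_hasCompactSupport hψRc.mul_left
  -- the far part: `|Q₂| ≤ Kf A` against `‖ψR‖₁ = R³ Pψ`
  have hfar : |∫ x, Q₂ x * ψR x| ≤ Kf * Pψ * A * R ^ 3 := by
    have hpt : ∀ x, |Q₂ x| ≤ Kf * A := fun x => hKf v A hvc hA R hRge x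
    calc |∫ x, Q₂ x * ψR x| ≤ ∫ x, Kf * A * |ψR x| := by
          rw [← Real.norm_eq_abs]
          refine norm_integral_le_of_norm_le ((hψRcont.abs.integrable_of_hasCompactSupport
            hψRc.abs).const_mul _) (Eventually.of_forall fun x => ?_)
          rw [Real.norm_eq_abs, abs_mul]
          exact mul_le_mul_of_nonneg_right (hpt x) (abs_nonneg _)
      _ = Kf * Pψ * A * R ^ 3 := by
          rw [integral_const_mul, hψR1]; ring
  -- the near part: Fubini and two integrations by parts, with the local energy
  have hnear : |∫ x, Q₁ x * ψR x| ≤ N₁ * D₂ * (rψ' + 3) * A * R ^ 3 := by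
    -- a bound for `G` on the relevant compact set
    have hK : IsCompact (tsupport ψR ×ˢ closedBall (0 : EuclideanSpace ℝ (Fin 3)) (R * 2)) :=
      hψRc.isCompact.prod (isCompact_closedBall _ _)
    obtain ⟨CG, hCG⟩ := (hK.image (continuous_fst.sub continuous_snd)).exists_bound_of_continuousOn
      hGc.continuousOn
    have hCG' : ∀ x ∈ tsupport ψR, ∀ z ∈ closedBall (0 : EuclideanSpace ℝ (Fin 3)) (R * 2),
        ‖G (x - z)‖ ≤ CG :=
      fun x hx z hz => hCG (x - z) ⟨(x, z), ⟨hx, hz⟩, rfl⟩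
    set CG' := max CG 0 with hCG'def
    have hCGle : ∀ x ∈ tsupport ψR, ∀ z ∈ closedBall (0 : EuclideanSpace ℝ (Fin 3)) (R * 2),
        ‖G (x - z)‖ ≤ CG' :=
      fun x hx z hz => (hCG' x hx z hz).trans (le_max_left _ _)
    -- the Fubini integrand and its integrability on the product
    set F : (EuclideanSpace ℝ (Fin 3)) → (EuclideanSpace ℝ (Fin 3)) → ℝ :=
      fun x z => ψR x * (newtonNear (R * 1) (R * 2) z * G (x - z)) with hF
    have hF_bound : ∀ x z, ‖F x z‖ ≤ (|ψR x| * CG') * |newtonNear (R * 1) (R * 2) z| := by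
      intro x z
      simp only [hF, Real.norm_eq_abs, abs_mul]
      by_cases hx : x ∈ tsupport ψR
      · by_cases hz : ‖z‖ ≤ R * 2
        · have := hCGle x hx z (mem_closedBall_zero_iff.2 hz)
          rw [Real.norm_eq_abs] at this
          calc |ψR x| * (|newtonNear (R * 1) (R * 2) z| * |G (x - z)|)
              ≤ |ψR x| * (|newtonNear (R * 1) (R * 2) z| * CG') := by gcongr
            _ = |ψR x| * CG' * |newtonNear (R * 1) (R * 2) z| := by ring
        · rw [newtonNear_eq_zero hR1.le hR2 (not_le.1 hz).le, abs_zero, zero_mul, mul_zero,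
            mul_zero]
      · rw [image_eq_zero_of_notMem_tsupport hx, abs_zero, zero_mul, zero_mul, zero_mul]
    have hF_meas : AEStronglyMeasurable (uncurry F)
        ((volume : Measure (EuclideanSpace ℝ (Fin 3))).prod volume) := by
      refine Measurable.aestronglyMeasurable ?_
      exact (hψRcont.measurable.comp measurable_fst).mul
        (((measurable_newtonNear _ _).comp measurable_snd).mul
          (hGc.measurable.comp (measurable_fst.sub measurable_snd)))
    have hF_int : Integrable (uncurry F)
        ((volume : Measure (EuclideanSpace ℝ (Fin 3))).prod volume) := by
      refine Integrable.mono' ?_ hF_meas (Eventually.of_forall fun q => hF_bound q.1 q.2)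
      exact ((hψRcont.abs.integrable_of_hasCompactSupport hψRc.abs).mul_const CG').mul_prod
        (integrable_newtonNear hR1.le hR2).abs
    -- Fubini
    have hswap : ∫ x, Q₁ x * ψR x =
        ∫ z, newtonNear (R * 1) (R * 2) z * ∫ x, ψR x * G (x - z) := by
      have e1 : (fun x => Q₁ x * ψR x) = fun x => ∫ z, F x z := by
        funext x
        rw [hQ₁, nearPotential, mul_comm, ← integral_const_mul]
      rw [e1, integral_integral_swap hF_int]
      refine integral_congr_ae (Eventually.of_forall fun z => ?_)
      show ∫ x, F x z = newtonNear (R * 1) (R * 2) z * ∫ x, ψR x * G (x - z)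
      rw [← integral_const_mul]
      refine integral_congr_ae (Eventually.of_forall fun x => ?_)
      simp only [hF]
      ring
    -- the local energy on the ball `B̄(x₀, R(rψ'+2))`: `∫ |v|² ≤ A R (rψ' + 3)`
    set Bw : Set (EuclideanSpace ℝ (Fin 3)) := closedBall x₀ (R * (rψ' + 2)) with hBw
    have hBw_fin : volume Bw < ⊤ := measure_closedBall_lt_top
    have henergy : ∫ w in Bw, ‖v w‖ ^ 2 ≤ A * (R * (rψ' + 2 + 1)) :=
      integral_closedBall_sq_le_of_morrey hvc hA x₀ hRge (by positivity)
    -- the inner integral after two integrations by parts, for `|z| ≤ 2R`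
    have hJ : ∀ z, ‖z‖ ≤ R * 2 →
        |∫ x, ψR x * G (x - z)| ≤ R⁻¹ ^ 2 * D₂ * (A * (R * (rψ' + 2 + 1))) := by
      intro z hz
      have e1 : ∫ x, ψR x * G (x - z) = ∫ w, ψR (w + z) * G w := by
        rw [← integral_add_right_eq_self (fun x => ψR x * G (x - z)) z]
        simp only [add_sub_cancel_right]
      have hθ : ContDiff ℝ 2 fun w => ψR (w + z) := hψRs.comp (contDiff_id.add contDiff_const)
      have hθc : HasCompactSupport fun w => ψR (w + z) :=
        hψRc.comp_homeomorph (Homeomorph.addRight z)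
      have e2 : ∫ w, ψR (w + z) * G w = ∫ w, fderiv ℝ (fderiv ℝ ψR) (w + z) (v w) (v w) := by
        rw [hG, integral_mul_pressureSource hθ hθc hv2]
        refine integral_congr_ae (Eventually.of_forall fun w => ?_)
        have h1 : fderiv ℝ (fun w => ψR (w + z)) = fun w => fderiv ℝ ψR (w + z) :=
          funext fun w => fderiv_comp_add_right z
        simp only [h1, fderiv_comp_add_right]
      rw [e1, e2, ← Real.norm_eq_abs]
      -- pointwise: the integrand vanishes off `Bw` and is `≤ R⁻² D₂ |v|²` on it
      have hpt : ∀ w, ‖fderiv ℝ (fderiv ℝ ψR) (w + z) (v w) (v w)‖ ≤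
          R⁻¹ ^ 2 * D₂ * Bw.indicator (fun w => ‖v w‖ ^ 2) w := by
        intro w
        by_cases hw : w ∈ Bw
        · rw [Set.indicator_of_mem hw]
          calc ‖fderiv ℝ (fderiv ℝ ψR) (w + z) (v w) (v w)‖
              ≤ ‖fderiv ℝ (fderiv ℝ ψR) (w + z) (v w)‖ * ‖v w‖ := ContinuousLinearMap.le_opNorm _ _
            _ ≤ ‖fderiv ℝ (fderiv ℝ ψR) (w + z)‖ * ‖v w‖ * ‖v w‖ := by
                gcongr; exact ContinuousLinearMap.le_opNorm _ _
            _ ≤ R⁻¹ ^ 2 * D₂ * ‖v w‖ * ‖v w‖ := by gcongr; exact hD2ψR _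
            _ = R⁻¹ ^ 2 * D₂ * ‖v w‖ ^ 2 := by ring
        · -- `w + z ∉ closedBall x₀ (R rψ')`, so `D²ψR (w + z) = 0`
          have hwz : w + z ∉ closedBall x₀ (R * rψ') := by
            intro hmem
            apply hw
            rw [mem_closedBall, dist_eq_norm] at hmem
            rw [hBw, mem_closedBall, dist_eq_norm]
            have : ‖w - x₀‖ ≤ ‖w + z - x₀‖ + ‖z‖ := by
              have := norm_sub_le (w + z - x₀) z
              rwa [show w + z - x₀ - z = w - x₀ by abel] at this
            nlinarith
          rw [hsuppD2 (w + z) hwz, Set.indicator_of_notMem hw]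
          simp
      have hind : Integrable (fun w => R⁻¹ ^ 2 * D₂ * Bw.indicator (fun w => ‖v w‖ ^ 2) w) := by
        refine Integrable.const_mul ?_ _
        rw [integrable_indicator_iff measurableSet_closedBall]
        exact (hvc.norm.pow 2).continuousOn.integrableOn_compact (isCompact_closedBall _ _)
      have hle := norm_integral_le_of_norm_le hind (Eventually.of_forall hpt)
      rw [integral_const_mul, integral_indicator measurableSet_closedBall] at hle
      exact hle.trans (mul_le_mul_of_nonneg_left henergy (by positivity))
    -- combine with `|z| > 2R ⇒ Γ₀^R(z) = 0`
    have hJ' : ∀ z, |newtonNear (R * 1) (R * 2) z| * |∫ x, ψR x * G (x - z)| ≤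
        |newtonNear (R * 1) (R * 2) z| * (R⁻¹ ^ 2 * D₂ * (A * (R * (rψ' + 2 + 1)))) := by
      intro z
      by_cases hz : ‖z‖ ≤ R * 2
      · exact mul_le_mul_of_nonneg_left (hJ z hz) (abs_nonneg _)
      · rw [newtonNear_eq_zero hR1.le hR2 (not_le.1 hz).le, abs_zero, zero_mul, zero_mul]
    rw [hswap, ← Real.norm_eq_abs]
    calc ‖∫ z, newtonNear (R * 1) (R * 2) z * ∫ x, ψR x * G (x - z)‖
        ≤ ∫ z, |newtonNear (R * 1) (R * 2) z| * (R⁻¹ ^ 2 * D₂ * (A * (R * (rψ' + 2 + 1)))) := by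
          refine norm_integral_le_of_norm_le ((integrable_newtonNear hR1.le hR2).abs.mul_const _)
            (Eventually.of_forall fun z => ?_)
          rw [Real.norm_eq_abs, abs_mul]
          exact hJ' z
      _ = N₁ * D₂ * (rψ' + 3) * A * R := by
          rw [integral_mul_const, integral_abs_newtonNear_scale hR, hN₁]
          field_simp
          ring
      _ ≤ N₁ * D₂ * (rψ' + 3) * A * R ^ 3 := by
          refine mul_le_mul_of_nonneg_left ?_ (by positivity)
          calc R = R * 1 * 1 := by ring
            _ ≤ R * R * R := by gcongr
            _ = R ^ 3 := by ring
  -- assembly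
  have iQ₁n : Integrable fun x => -(Q₁ x * ψR x) := iQ₁.neg
  rw [hQ, integral_sub iQ₁n iQ₂, integral_neg]
  calc |-(∫ x, Q₁ x * ψR x) - ∫ x, Q₂ x * ψR x|
      ≤ |∫ x, Q₁ x * ψR x| + |∫ x, Q₂ x * ψR x| := by
        rw [show -(∫ x, Q₁ x * ψR x) - ∫ x, Q₂ x * ψR x =
          -((∫ x, Q₁ x * ψR x) + ∫ x, Q₂ x * ψR x) by ring, abs_neg]
        exact abs_add_le _ _
    _ ≤ N₁ * D₂ * (rψ' + 3) * A * R ^ 3 + Kf * Pψ * A * R ^ 3 := add_le_add hnear hfar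
    _ = (Kf * Pψ + N₁ * D₂ * (rψ' + 3)) * A * R ^ 3 := by ring

/-- **Potential probe term, Morrey class**: `|∫ ∂ₐχ_R(z) Q[v](x₀ − z) dz| ≤ K A R⁻¹` for
`R ≥ 1` (the duality bound `exists_abs_integral_pressurePotential_mul_le_morrey` at scale `R`,
times the normalisation `R⁻⁴` of `∂ₐχ_R`). [cite: Tao2011, §4, proof of Lemma 4.1 (i)] -/
theorem exists_bound_probe_potential_morrey (a : EuclideanSpace ℝ (Fin 3)) :
    ∃ K, 0 ≤ K ∧ ∀ (v : (EuclideanSpace ℝ (Fin 3)) → (EuclideanSpace ℝ (Fin 3))) (A : ℝ),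
    ContDiff ℝ 2 v →
    (∀ (x : EuclideanSpace ℝ (Fin 3)) (r : ℝ), 1 ≤ r → ∫ y in ball x r, ‖v y‖ ^ 2 ≤ A * r) →
    ∀ (R : ℝ), 1 ≤ R → ∀ x₀ : EuclideanSpace ℝ (Fin 3),
      |∫ z, fderiv ℝ (probeBump R) z a * pressurePotential v (x₀ - z)| ≤ K * A * R⁻¹ := by
  set m := baseBumpMass (EuclideanSpace ℝ (Fin 3)) with hm
  have hm0 : 0 < m := baseBumpMass_pos
  -- the fixed test function `ψ(s) = m⁻¹ ∂ₐθ(-s)`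
  set ψ : (EuclideanSpace ℝ (Fin 3)) → ℝ := fun s => m⁻¹ * fderiv ℝ baseBump (-s) a with hψ
  have hψs : ContDiff ℝ 2 ψ :=
    contDiff_const.mul ((((contDiff_baseBump (E := EuclideanSpace ℝ (Fin 3)) (n := 3)).fderiv_right
      (m := 2) (by norm_num)).comp contDiff_neg).clm_apply contDiff_const)
  have hψc : HasCompactSupport ψ := by
    have h1 : HasCompactSupport fun s : EuclideanSpace ℝ (Fin 3) => fderiv ℝ baseBump (-s) a :=
      ((hasCompactSupport_baseBump (E := EuclideanSpace ℝ (Fin 3))).fderiv_apply (𝕜 := ℝ) a).comp_homeomorph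
        (Homeomorph.neg (EuclideanSpace ℝ (Fin 3)))
    exact h1.mul_left
  obtain ⟨M, hM0, hM⟩ := exists_abs_integral_pressurePotential_mul_le_morrey hψs hψc
  refine ⟨M, hM0, ?_⟩
  intro v A hv2 hA R hR1 x₀
  have hR : 0 < R := one_pos.trans_le hR1
  have hd : Module.finrank ℝ (EuclideanSpace ℝ (Fin 3)) = 3 := finrank_euclideanSpace_fin
  -- rewrite the probe integral as `R⁻⁴ ∫ Q ψ_R`
  have hker : ∀ y, fderiv ℝ (probeBump R) (x₀ - y) a = R⁻¹ ^ 4 * ψ (R⁻¹ • (y - x₀)) := by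
    intro y
    rw [fderiv_probeBump_apply hR, hd, hψ]
    simp only [smul_sub, neg_sub]
    rw [← hm]
    field_simp
  have e1 : ∫ z, fderiv ℝ (probeBump R) z a * pressurePotential v (x₀ - z) =
      R⁻¹ ^ 4 * ∫ y, pressurePotential v y * ψ (R⁻¹ • (y - x₀)) := by
    rw [← integral_sub_left_eq_self
      (fun z => fderiv ℝ (probeBump R) z a * pressurePotential v (x₀ - z)) volume x₀,
      ← integral_const_mul]
    refine integral_congr_ae (Eventually.of_forall fun y => ?_)
    simp only [sub_sub_cancel, hker y]
    ring
  rw [e1, abs_mul, abs_of_pos (by positivity : (0 : ℝ) < R⁻¹ ^ 4)]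
  calc R⁻¹ ^ 4 * |∫ y, pressurePotential v y * ψ (R⁻¹ • (y - x₀))|
      ≤ R⁻¹ ^ 4 * (M * A * R ^ 3) :=
        mul_le_mul_of_nonneg_left (hM v A hv2 hA x₀ R hR1) (by positivity)
    _ = M * A * R⁻¹ := by field_simp

end Summit.NavierStokesRegularity.NavierStokesRegularity.Theorems.SingularProfile
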